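import Mathlib.Data.List.GetD
import Mathlib.Data.Prod.Lex
import Literature.Computability.AlgebraicComplexity.CwSquareKoszulCert
import Literature.LinearAlgebra.Matrix.RowOperationCertificate
import HarnessLib

/-!
# Proof of CGLV 2022, Thm. 3.3 (the rank): `rank((φ₂ T_{cw,q}^{⊠2})^{∧1}_{A'}) = 2(q+2)²`, all `q ≥ 4`

Topic `Literature/Computability/AlgebraicComplexity`.  This file discharges the named fact
`CGLV2022_thm33_koszulRank` of `BorderRankCWKoszulRanks.lean` (Conner–Gesmundo–Landsberg–Ventura,
*Rank and border rank of Kronecker powers of tensors and Strassen's laser method*, comput.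
complexity 31 (2022) = arXiv:1909.04785, Thm. 3.3, proof): for every `q ≥ 4` the `p = 1` Koszul
flattening of `φ₂(T_{cw,q}^{⊠2})` has rank exactly `2(q+2)²` (`CGLV2022_thm33_koszulRank_holds`).

* Upper bound: `rank ≤ C(2,1) · bR(T_{cw,q}^{⊠2}) ≤ 2 (q+2)²` (the Koszul-flattening bound
  `rank_koszulFlattening_le_choose_mul_algBorderRank` and submultiplicativity
  `algBorderRank_kroneckerPow_cwTensor_le`, both in the tree).
* Lower bound — the source's SECOND proof (§3.5), made elementary: by
  `CwSquareKoszulKronecker.lean` the flattening is `∑_j Inc_j ⊗ Φ_j`; by `CwSquareKoszulBasis.lean`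
  `rank ≥ rank K̃` with `K̃ = (1 ⊗ U' ⊗ U') K (1 ⊗ U ⊗ U)` block diagonal in the index types
  `ff, fs, sf, ss`; by `CwSquareKoszulCert.lean` the blocks are fixed polynomial matrices in
  `t = q - 3` with kernel-checked triangular certificates of sizes `72`, `12`, `12`, `2`.  Here the
  certificates are assembled into one key-triangular family of `72 + 24(q-4) + 2(q-4)² = 2(q+2)²`
  row combinations of `K̃` (`certificate`: rows indexed by
  `CertIdx q = Fin 72 ⊕ Fin 12 × Fin (q-4) ⊕ Fin 12 × Fin (q-4) ⊕ Fin 2 × Fin (q-4)²`, ranked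
  lexicographically), so `rank K̃ ≥ 2(q+2)²` by `card_le_rank_of_keyTriangular_mul`.

On the printed proofs: the first proof of Thm. 3.3 (induction on `q`) asserts a block-triangular
shape `[[M₁₁+N₁₁, N₁₂],[0, N₂₂]]` of the flattening with respect to "index `q` involved or not";
that lower-left block is in fact NOT zero (e.g. the term `a_{q0} ⊗ b_{0j} ⊗ c_{qj}` of
`T_{cw,q}^{⊠2}` with `φ₂(a_{q0}) = e₁` contributes to it; checked numerically, rank `4(q-1)`), so that
route is not followed; the second proof's count `72·1 + 12(q-4) + 12(q-4) + 2(q-4)²` is exactly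
what is certified here, with the isotypic decomposition replaced by the explicit dual bases
`(γ_k), (f_l)` of `CwSquareKoszulBasis.lean`.

## References

* A. Conner, F. Gesmundo, J. M. Landsberg, E. Ventura, comput. complexity 31 (2022), Thm. 3.3 and
  §3.5; arXiv:1909.04785. [ConnerGesmundoLandsbergVentura2022]
-/

noncomputable section

open Matrix

namespace Literature.Computability.AlgebraicComplexity

namespace CGLVThm33

open Literature.Algebra.Polynomial Literature.LinearAlgebra.Matrix

variable {q : ℕ}

/-! ## Indexing the certificate rows and columns -/

/-- The row index type of the certificate: `72` combined `ff` rows, `12 (q-4)` rows of type `fs`,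
`12 (q-4)` of type `sf`, `2 (q-4)²` of type `ss`. [folklore] -/
abbrev CertIdx (q : ℕ) : Type :=
  Fin 72 ⊕ ((Fin 12 × Fin (q - 4)) ⊕ ((Fin 12 × Fin (q - 4)) ⊕ (Fin 2 × Fin (q - 4) × Fin (q - 4))))

/-- `|CertIdx q| = 2 (q+2)²` for `q ≥ 4`. [folklore] -/
theorem card_CertIdx (hq : 4 ≤ q) : Fintype.card (CertIdx q) = 2 * (q + 2) ^ 2 := by
  obtain ⟨r, rfl⟩ : ∃ r, q = r + 4 := ⟨q - 4, by omega⟩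
  simp only [CertIdx, Fintype.card_sum, Fintype.card_prod, Fintype.card_fin, Nat.add_sub_cancel]
  ring

/-- A number `< 3` as an element of `Fin 3`. [folklore] -/
def f3 (n : ℕ) : Fin 3 := ⟨n % 3, Nat.mod_lt _ (by decide)⟩

/-- A number `< 5` as an element of `Fin 5`. [folklore] -/
def f5 (n : ℕ) : Fin 5 := ⟨n % 5, Nat.mod_lt _ (by decide)⟩

/-- Row `r < 75` of the `ff` block: `(T, k₀, k₁) = (r / 25, r / 5 % 5, r % 5)`. [folklore] -/
def ffRow (hq : 4 ≤ q) (r : Fin 75) : PSub 3 2 × (Fin (q + 1) × Fin (q + 1)) :=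
  (pairOf (f3 (r / 25)), (fin5 hq (f5 (r / 5)), fin5 hq (f5 r)))

/-- The row of `K̃` picked by a certificate index of type `fs`, `sf`, `ss` (for `ff` indices the
certificate row is a combination of `ff` rows, see `Pbig`; the value here is unused). [folklore] -/
def rowOf (hq : 4 ≤ q) : CertIdx q → PSub 3 2 × (Fin (q + 1) × Fin (q + 1))
  | .inl _ => ffRow hq 0
  | .inr (.inl (a, s)) =>
      (pairOf (f3 (fsMinorRows.getD a 0 / 5)), (fin5 hq (f5 (fsMinorRows.getD a 0)), stdIdx s))
  | .inr (.inr (.inl (a, s))) =>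
      (pairOf (f3 (sfMinorRows.getD a 0 / 5)), (stdIdx s, fin5 hq (f5 (sfMinorRows.getD a 0))))
  | .inr (.inr (.inr (a, s0, s1))) => (pairOf (f3 (ssMinorRows.getD a 0)), (stdIdx s0, stdIdx s1))

/-- The pivot column of `K̃` of a certificate index. [folklore] -/
def colOf (hq : 4 ≤ q) : CertIdx q → PSub 3 1 × (Fin (q + 1) × Fin (q + 1))
  | .inl b => (singOf (f3 (ffPivCols.getD b 0 / 25)),
      (fin5 hq (f5 (ffPivCols.getD b 0 / 5)), fin5 hq (f5 (ffPivCols.getD b 0))))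
  | .inr (.inl (b, s)) =>
      (singOf (f3 (fsMinorCols.getD b 0 / 5)), (fin5 hq (f5 (fsMinorCols.getD b 0)), stdIdx s))
  | .inr (.inr (.inl (b, s))) =>
      (singOf (f3 (sfMinorCols.getD b 0 / 5)), (stdIdx s, fin5 hq (f5 (sfMinorCols.getD b 0))))
  | .inr (.inr (.inr (b, s0, s1))) => (singOf (f3 (ssMinorCols.getD b 0)), (stdIdx s0, stdIdx s1))

/-- The coefficient matrix `P` of the certificate: row `a < 72` is the combination `P̃_a` of the
`ff` rows, the other rows are unit vectors. [folklore] -/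
def Pbig (hq : 4 ≤ q) : Matrix (CertIdx q) (PSub 3 2 × (Fin (q + 1) × Fin (q + 1))) ℂ
  | .inl a => fun ρ => ∑ r : Fin 75,
      CoeffList.rowVec (tq ℂ q) (ffCertRows.getD a []) 75 r * (if ρ = ffRow hq r then 1 else 0)
  | .inr x => fun ρ => if ρ = rowOf hq (.inr x) then 1 else 0

/-- The lexicographic ranking of certificate indices: by type, then certificate row, then the
standard indices. [folklore] -/
def certKey : CertIdx q → ℕ ×ₗ (ℕ ×ₗ (ℕ ×ₗ ℕ))
  | .inl a => toLex (0, toLex ((a : ℕ), toLex (0, 0)))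
  | .inr (.inl (a, s)) => toLex (1, toLex ((a : ℕ), toLex ((s : ℕ), 0)))
  | .inr (.inr (.inl (a, s))) => toLex (2, toLex ((a : ℕ), toLex ((s : ℕ), 0)))
  | .inr (.inr (.inr (a, s0, s1))) => toLex (3, toLex ((a : ℕ), toLex ((s0 : ℕ), (s1 : ℕ))))

/-- `certKey` is injective. [folklore] -/
theorem certKey_injective : Function.Injective (certKey (q := q)) := by
  rintro (a | ⟨a, s⟩ | ⟨a, s⟩ | ⟨a, s0, s1⟩) (b | ⟨b, s'⟩ | ⟨b, s'⟩ | ⟨b, s0', s1'⟩) h <;>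
    simp_all [certKey, Prod.ext_iff, Fin.ext_iff]

/-! ## The entries of `P K̃` -/

/-- Rows of type `ff` of `P K̃` are the combinations `∑_r P̃_{a r} K̃_{row r}`. [folklore] -/
theorem PK_inl (hq : 4 ≤ q) (a : Fin 72) (c : PSub 3 1 × (Fin (q + 1) × Fin (q + 1))) :
    (Pbig hq * Ktil ℂ q) (.inl a) c =
      ∑ r : Fin 75, CoeffList.rowVec (tq ℂ q) (ffCertRows.getD a []) 75 r * Ktil ℂ q (ffRow hq r) c := by
  simp only [Matrix.mul_apply, Pbig, Finset.sum_mul, mul_assoc, ite_mul, one_mul, zero_mul]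
  rw [Finset.sum_comm]
  refine Finset.sum_congr rfl fun r _ => ?_
  rw [← Finset.mul_sum, Finset.sum_ite_eq']
  simp

/-- The other rows of `P K̃` are rows of `K̃`. [folklore] -/
theorem PK_inr (hq : 4 ≤ q) (x : (Fin 12 × Fin (q - 4)) ⊕ ((Fin 12 × Fin (q - 4)) ⊕ (Fin 2 × Fin (q - 4) × Fin (q - 4))))
    (c : PSub 3 1 × (Fin (q + 1) × Fin (q + 1))) :
    (Pbig hq * Ktil ℂ q) (.inr x) c = Ktil ℂ q (rowOf hq (.inr x)) c := by
  simp only [Matrix.mul_apply, Pbig, ite_mul, one_mul, zero_mul, Finset.sum_ite_eq', Finset.mem_univ,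
    if_true]

/-- All row indices of the `ff` certificate are `< 75`. [folklore] -/
theorem ffCertRows_getD_lt (a : ℕ) : ∀ rc ∈ ffCertRows.getD a [], rc.1 < 75 := by
  intro rc hrc
  have hall := ffCertRows_lt
  rw [List.all_eq_true] at hall
  by_cases ha : a < ffCertRows.length
  · have hmem : ffCertRows.getD a [] ∈ ffCertRows := by
      rw [List.getD_eq_getElem _ _ ha]
      exact List.getElem_mem ha
    have := hall _ hmem
    rw [List.all_eq_true] at this
    simpa using this rc hrc
  · rw [List.getD_eq_default _ _ (by omega)] at hrc
    simp at hrc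

/-- `t = q - 3` as a natural number cast. [folklore] -/
theorem tq_eq_natCast (hq : 3 ≤ q) : tq ℂ q = ((q - 3 : ℕ) : ℂ) := by
  simp [tq, Nat.cast_sub hq]

/-- The `ff/ff` entries of `P K̃` are the certificate values `(P̃ B_ff)_{ab}`. [folklore] -/
theorem PK_ff (hq : 4 ≤ q) (a b : Fin 72) :
    (Pbig hq * Ktil ℂ q) (.inl a) (colOf hq (.inl b)) = CoeffList.eval (tq ℂ q) (ffU a b) := by
  rw [PK_inl, ffU, CoeffList.eval_sdot_eq_sum (tq ℂ q) _
    (fun r : Fin 75 => ktE true true (r / 25 % 3) (r / 5 % 5) (r % 5) (ffPivCols.getD b 0 / 25 % 3)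
      (ffPivCols.getD b 0 / 5 % 5) (ffPivCols.getD b 0 % 5)) (fun r => rfl) _ (ffCertRows_getD_lt a)]
  refine Finset.sum_congr rfl fun r _ => ?_
  simp only [ffRow, colOf, Ktil_ff hq, f3, f5]

/-- The `fs/fs` entries of `P K̃`. [folklore] -/
theorem PK_fs (hq : 4 ≤ q) (a b : Fin 12) (s s' : Fin (q - 4)) :
    (Pbig hq * Ktil ℂ q) (.inr (.inl (a, s))) (colOf hq (.inr (.inl (b, s')))) =
      if (s : ℕ) = s' then CoeffList.eval (tq ℂ q) (fsE a b) else 0 := by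
  rw [PK_inr]
  simp only [rowOf, colOf, Ktil_fs hq, f3, f5, fsE]

/-- The `sf/sf` entries of `P K̃`. [folklore] -/
theorem PK_sf (hq : 4 ≤ q) (a b : Fin 12) (s s' : Fin (q - 4)) :
    (Pbig hq * Ktil ℂ q) (.inr (.inr (.inl (a, s)))) (colOf hq (.inr (.inr (.inl (b, s'))))) =
      if (s : ℕ) = s' then CoeffList.eval (tq ℂ q) (sfE a b) else 0 := by
  rw [PK_inr]
  simp only [rowOf, colOf, Ktil_sf hq, f3, f5, sfE]

/-- The `ss/ss` entries of `P K̃`. [folklore] -/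
theorem PK_ss (hq : 4 ≤ q) (a b : Fin 2) (s0 s1 s0' s1' : Fin (q - 4)) :
    (Pbig hq * Ktil ℂ q) (.inr (.inr (.inr (a, s0, s1)))) (colOf hq (.inr (.inr (.inr (b, s0', s1'))))) =
      if (s0 : ℕ) = s0' ∧ (s1 : ℕ) = s1' then CoeffList.eval (tq ℂ q) (ssE a b) else 0 := by
  rw [PK_inr]
  simp only [rowOf, colOf, Ktil_ss, f3, ssE]

/-! ## Key-triangularity -/

/-- Ranking within type `ff`. [folklore] -/
theorem certKey_lt_ff {a b : Fin 72} (h : certKey (q := q) (.inl b) < certKey (q := q) (.inl a)) : (b : ℕ) < a := by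
  simp [certKey, Prod.Lex.toLex_lt_toLex] at h
  omega

/-- Ranking within type `fs`. [folklore] -/
theorem certKey_lt_fs {a b : Fin 12} {s s' : Fin (q - 4)}
    (h : certKey (.inr (.inl (b, s'))) < certKey (.inr (.inl (a, s)))) :
    (b : ℕ) < a ∨ ((b : ℕ) = a ∧ (s' : ℕ) < s) := by
  simp [certKey, Prod.Lex.toLex_lt_toLex] at h
  omega

/-- Ranking within type `sf`. [folklore] -/
theorem certKey_lt_sf {a b : Fin 12} {s s' : Fin (q - 4)}
    (h : certKey (.inr (.inr (.inl (b, s')))) < certKey (.inr (.inr (.inl (a, s))))) :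
    (b : ℕ) < a ∨ ((b : ℕ) = a ∧ (s' : ℕ) < s) := by
  simp [certKey, Prod.Lex.toLex_lt_toLex] at h
  omega

/-- Ranking within type `ss`. [folklore] -/
theorem certKey_lt_ss {a b : Fin 2} {s0 s1 s0' s1' : Fin (q - 4)}
    (h : certKey (.inr (.inr (.inr (b, s0', s1')))) < certKey (.inr (.inr (.inr (a, s0, s1))))) :
    (b : ℕ) < a ∨ ((b : ℕ) = a ∧ ((s0' : ℕ) < s0 ∨ ((s0' : ℕ) = s0 ∧ (s1' : ℕ) < s1))) := by
  simp [certKey, Prod.Lex.toLex_lt_toLex] at h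
  omega

/-- Below the certKey-diagonal `P K̃` vanishes on the pivot columns. [folklore] -/
theorem PK_lower (hq : 4 ≤ q) (i j : CertIdx q) (hij : certKey j < certKey i) :
    (Pbig hq * Ktil ℂ q) i (colOf hq j) = 0 := by
  rcases i with a | ⟨a, s⟩ | ⟨a, s⟩ | ⟨a, s0, s1⟩ <;> rcases j with b | ⟨b, s'⟩ | ⟨b, s'⟩ | ⟨b, s0', s1'⟩
  -- ff / ff
  · rw [PK_ff]
    exact CoeffList.eval_eq_zero_of_isZero _ _ ((triCheck_spec ffCheck a.2 b.2).1 (certKey_lt_ff hij))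
  -- ff / fs, sf, ss
  · rw [PK_inl]
    exact Finset.sum_eq_zero fun r _ => by simp only [ffRow, colOf, Ktil_f_s_snd hq, mul_zero]
  · rw [PK_inl]
    exact Finset.sum_eq_zero fun r _ => by simp only [ffRow, colOf, Ktil_f_s_fst hq, mul_zero]
  · rw [PK_inl]
    exact Finset.sum_eq_zero fun r _ => by simp only [ffRow, colOf, Ktil_f_s_fst hq, mul_zero]
  -- fs / ff
  · rw [PK_inr]; simp only [rowOf, colOf, Ktil_s_f_snd hq]
  -- fs / fs
  · rw [PK_fs]
    rcases certKey_lt_fs hij with h | ⟨-, h⟩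
    · rw [CoeffList.eval_eq_zero_of_isZero _ _ ((triCheck_spec fsCheck a.2 b.2).1 h)]
      simp
    · rw [if_neg (by omega)]
  -- fs / sf, ss
  · rw [PK_inr]; simp only [rowOf, colOf, Ktil_f_s_fst hq]
  · rw [PK_inr]; simp only [rowOf, colOf, Ktil_f_s_fst hq]
  -- sf / ff, fs
  · rw [PK_inr]; simp only [rowOf, colOf, Ktil_s_f_fst hq]
  · rw [PK_inr]; simp only [rowOf, colOf, Ktil_s_f_fst hq]
  -- sf / sf
  · rw [PK_sf]
    rcases certKey_lt_sf hij with h | ⟨-, h⟩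
    · rw [CoeffList.eval_eq_zero_of_isZero _ _ ((triCheck_spec sfCheck a.2 b.2).1 h)]
      simp
    · rw [if_neg (by omega)]
  -- sf / ss
  · rw [PK_inr]; simp only [rowOf, colOf, Ktil_f_s_snd hq]
  -- ss / ff, fs, sf
  · rw [PK_inr]; simp only [rowOf, colOf, Ktil_s_f_fst hq]
  · rw [PK_inr]; simp only [rowOf, colOf, Ktil_s_f_fst hq]
  · rw [PK_inr]; simp only [rowOf, colOf, Ktil_s_f_snd hq]
  -- ss / ss
  · rw [PK_ss]
    rcases certKey_lt_ss hij with h | ⟨-, h⟩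
    · rw [CoeffList.eval_eq_zero_of_isZero _ _ ((triCheck_spec ssCheck a.2 b.2).1 h)]
      simp
    · rw [if_neg (by omega)]

/-- On the certKey-diagonal `P K̃` is non-zero (`t = q - 3 ≥ 1`). [folklore] -/
theorem PK_diag (hq : 4 ≤ q) (i : CertIdx q) : (Pbig hq * Ktil ℂ q) i (colOf hq i) ≠ 0 := by
  have ht : 1 ≤ q - 3 := by omega
  rcases i with a | ⟨a, s⟩ | ⟨a, s⟩ | ⟨a, s0, s1⟩
  · rw [PK_ff, tq_eq_natCast (by omega)]
    exact CoeffList.eval_ne_zero_of_sameSign ht _ ((triCheck_spec ffCheck a.2 a.2).2 rfl)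
  · rw [PK_fs, if_pos rfl, tq_eq_natCast (by omega)]
    exact CoeffList.eval_ne_zero_of_sameSign ht _ ((triCheck_spec fsCheck a.2 a.2).2 rfl)
  · rw [PK_sf, if_pos rfl, tq_eq_natCast (by omega)]
    exact CoeffList.eval_ne_zero_of_sameSign ht _ ((triCheck_spec sfCheck a.2 a.2).2 rfl)
  · rw [PK_ss, if_pos ⟨rfl, rfl⟩, tq_eq_natCast (by omega)]
    exact CoeffList.eval_ne_zero_of_sameSign ht _ ((triCheck_spec ssCheck a.2 a.2).2 rfl)

/-- **The certificate**: `rank K̃_q ≥ |CertIdx q| = 2(q+2)²` for `q ≥ 4`.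
[cite: ConnerGesmundoLandsbergVentura2022, Thm. 3.3 (proof), §3.5] -/
theorem card_le_rank_Ktil (hq : 4 ≤ q) : Fintype.card (CertIdx q) ≤ (Ktil ℂ q).rank :=
  card_le_rank_of_keyTriangular_mul (Ktil ℂ q) (Pbig hq) (colOf hq) certKey certKey_injective
    (PK_diag hq) (PK_lower hq)

/-- `rank K̃_q ≤ rank K_q` (the sandwich identity). [cite: ConnerGesmundoLandsbergVentura2022, §3.5] -/
theorem rank_Ktil_le (hq : 4 ≤ q) :
    (Ktil ℂ q).rank ≤ (koszulFlattening 1 (cglvPhi2 ℂ q).mulVecLin (kroneckerPow (cwTensor ℂ q) 2)).rank := by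
  rw [← Matrix.rank_reindex (pairEquiv q 2) (pairEquiv q 1), koszulFlattening_cglvPhi2_reindex,
    ← sandwich_Kx hq]
  exact (Matrix.rank_mul_le_left _ _).trans (Matrix.rank_mul_le_right _ _)

/-- **CGLV 2022, Thm. 3.3, the rank**: for every `q ≥ 4`,
`rank((φ₂ T_{cw,q}^{⊠2})^{∧1}_{A'}) = 2(q+2)²`. [cite: ConnerGesmundoLandsbergVentura2022, Thm. 3.3 (proof)] -/
theorem rank_koszulFlattening_cglvPhi2 (hq : 4 ≤ q) :
    (koszulFlattening 1 (cglvPhi2 ℂ q).mulVecLin (kroneckerPow (cwTensor ℂ q) 2)).rank =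
      2 * (q + 2) ^ 2 := by
  apply le_antisymm
  · have h1 := rank_koszulFlattening_le_choose_mul_algBorderRank 1 (cglvPhi2 ℂ q)
      (kroneckerPow (cwTensor ℂ q) 2)
    have h2 := algBorderRank_kroneckerPow_cwTensor_le ℂ q 2
    rw [show Nat.choose (2 * 1) 1 = 2 by decide] at h1
    exact h1.trans (Nat.mul_le_mul_left 2 h2)
  · calc 2 * (q + 2) ^ 2 = Fintype.card (CertIdx q) := (card_CertIdx hq).symm
      _ ≤ (Ktil ℂ q).rank := card_le_rank_Ktil hq
      _ ≤ _ := rank_Ktil_le hq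

end CGLVThm33

/-- **CGLV 2022, Thm. 3.3 (proof), the rank — discharged**: for every `q ≥ 4` the `p = 1` Koszul
flattening of `φ₂(T_{cw,q}^{⊠2})` has rank `2(q+2)²`. [cite: ConnerGesmundoLandsbergVentura2022, Thm. 3.3 (proof)] -/
theorem CGLV2022_thm33_koszulRank_holds : CGLV2022_thm33_koszulRank :=
  fun _ hq => CGLVThm33.rank_koszulFlattening_cglvPhi2 hq

end Literature.Computability.AlgebraicComplexity

end
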